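import Mathlib.Algebra.Order.Floor.Defs
import Mathlib.Algebra.Order.Floor.Ring
import Mathlib.Algebra.Order.Field.Basic
import Mathlib.Algebra.Ring.Parity
import Mathlib.Order.Interval.Finset.Nat
import Mathlib.Algebra.BigOperators.Ring.Finset
import Mathlib.Algebra.BigOperators.Intervals
import Mathlib.Algebra.BigOperators.Field
import Mathlib.Algebra.Order.BigOperators.Group.Finset
import Mathlib.Tactic.Linarith
import Mathlib.Tactic.Positivity
import Mathlib.Tactic.Ring
import Mathlib.Tactic.FieldSimp
import Literature.ComputerArithmetic.P3109.StochasticModes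
import Literature.ComputerArithmetic.FitzgibbonFelix2025.FewBitSR
import HarnessLib

/-!
# Fitzgibbon–Felix 2025, §III-C–F / App. A: the seven bias facts of `FewBitSR.lean` PROVED — Literature-side DISCHARGE

RE-HOMED into Literature (seat zeta5-irr-lit g8 — idle-time fleet service, 2026-08-27; HIDDEN-DISCHARGES sweep rows `SRFFGridBias`,
`SRFFGridBiasLe`, `SRFGridBias`, `SRFGridBiasLe`, `SRCGridBias`, `SRFFContBias`, `SRFContBias`,
run/shared/lean/pub/bsd-rank2/lit/HIDDEN-DISCHARGES.md — Literature named facts whose proofs lived only under Summits/):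
this file is a verbatim twin of `Summits/Ventures/CertifiedArithmetic/LowPrec/{SRLimitedBitsCounts, SRFewBitsGridBias,
SRFewBitsDictionary}.lean` (venture CertifiedArithmetic / lowprec, SR slice, files I / LXVIII / LXIX — the authors of the mathematics),
one namespace change `Summit.Ventures.CertifiedArithmetic.LowPrec.SR.LimitedBits` ↦ `Literature.ComputerArithmetic.FitzgibbonFelix2025.LimitedBits`,
each file scoped in its own `section`, cite tags added per declaration, and the seven discharges
`Literature.ComputerArithmetic.FitzgibbonFelix2025.<Fact>_holds : <Fact>` moved (proofs verbatim) into the facts' namespace so that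
Literature importers can feed `(h : SRFFGridBias)` etc. The four small definitions of file I (`awayCount`, `probAwayA/B/C` — the
per-word away counts / probabilities of the three modes) travel with it; NO new named fact (net debt −7). Summit files untouched.

What is proved, as printed [FitzgibbonFelix2025 = A. Fitzgibbon, S. Felix, *On Stochastic Rounding with Few Random Bits*, ARITH 2025,
arXiv:2504.20634]: §III-C / App. A-A `bias_SRFF = −2^{−(N+1)}` and §III-D / App. A-B `bias_SRF = 0` over residuals uniform on `[0,1)`;
§III-E / App. A-C `bias_{SRFF,D} ≤ (2^{−D} − 2^{−N})/2`, "tight for N ≤ D"; App. A-D `bias_{SRF,D} ≤ 2^{−(D+1)}` with equality for `N < D`;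
§III-F (eq. (8), round-to-nearest-even pre-rounding) SRC unbiased on every input grid for `1 ≤ N ≤ D` — exactly the seven `def … : Prop`
of `FewBitSR.lean`, whose docstrings quote the source. HONEST FRAMING (venture CertifiedArithmetic): certified statements about the
printed decision rules; no hardware or vendor claims; nothing here is new relative to the three Summit files.

## References
* [FitzgibbonFelix2025] A. Fitzgibbon, S. Felix, *On Stochastic Rounding with Few Random Bits*, 32nd IEEE Symposium on Computer
  Arithmetic (ARITH 2025), 133–140, doi:10.1109/arith64983.2025.00029 = arXiv:2504.20634 (typed in `FewBitSR.lean`, whose per-fact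
  cites are repeated on the discharges below).

The three original module headers follow verbatim.

## (1/3) `SRLimitedBitsCounts.lean`
# Limited-randomness SR (P3109 StochasticA/B/C), I: exact away-counts and away-probabilities

HONEST FRAMING: certified error envelopes and provably optimal rounding/accumulation schemes for
low-precision formats under stated cost models; every table by two implementations; no hardware or
vendor claims.

Venture CertifiedArithmetic / lowprec, SR slice. New work over the published P3109 decision rules
(`Literature.ComputerArithmetic.P3109`: `StochasticA/B/C`, `RNITE`, [FitzgibbonWintersteigerSarnoff2026]
Fig. 2): with `N` uniformly random bits and truncated fraction `0 ≤ η < 1`, the number of random words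
that round away from zero is EXACTLY `⌊η 2^N⌋` (A), `⌊η 2^N + 1/2⌋` (B, via
`⌊(⌊2y⌋ + 1)/2⌋ = ⌊y + 1/2⌋`), `RNITE(η 2^N)` (C) — `awayCount_stochasticA/B/B'/C`; hence the
away-probabilities `probAwayA/B/C` and their deviation from the exact-SR probability `η`:
A in `(−2^{-N}, 0]` (towards zero), B and C within `±2^{-(N+1)}`; each maps `[0,1]` into `[0,1]`.
File II (`SRLimitedBits`) turns these into per-step and n-step bias bounds in the saturating
finite-format model. Input-averaged bias statements for these modes (SRFF/SRF/SRC) are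
[FitzgibbonFelix2025] §III; the per-input probabilities here are what the cell's P3109 tables tabulate.

## (2/3) `SRFewBitsGridBias.lean`
# Few-bit stochastic rounding: EXACT input-averaged bias of the P3109 modes A / B / C on every
# finite input grid (venture file LXVIII of the SR slice)

HONEST FRAMING: certified error envelopes and provably optimal rounding/accumulation schemes for
low-precision formats under stated cost models; every table by two implementations; no hardware
or vendor claims.

Venture CertifiedArithmetic / lowprec, SR slice.  Setting of [FitzgibbonFelix2025] §III-E: the value
to be rounded carries `D` excess bits, i.e. its residual on the gap of the target format is one of
the `2^D` equally likely grid points `x_i = i / 2^D`; the rounding uses `N` uniformly random bits.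
File `SRLimitedBitsCounts` gives the EXACT per-input away-probabilities of the three IEEE P3109
stochastic modes, `P_A(x) = ⌊x 2^N⌋/2^N` (= SRFF of [FitzgibbonFelix2025], = `SR_{p,r}` of
[ElararEtAl2025]), `P_B(x) = ⌊x 2^N + ½⌋/2^N` (= SRF), `P_C(x) = RNITE(x 2^N)/2^N` (= SRC with
round-to-nearest-even pre-rounding; the dictionary is file LXIX, `SRFewBitsDictionary`).  Here we
prove the input-AVERAGED bias `2^{-D} Σ_{i<2^D} (P(x_i) − x_i)` EXACTLY for every `(N, D)`:

| mode | `N ≤ D` (`D` excess bits not resolved) | `D ≤ N` |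
|---|---|---|
| A (SRFF) | `−(2^{-N} − 2^{-D})/2` (`gridAvg_probAwayA`) | `0` (`gridAvg_probAwayA_of_le`) |
| B (SRF) | `+2^{-(D+1)}` for `N < D` (`gridAvg_probAwayB`) | `0` (`gridAvg_probAwayB_of_le`) |
| C (SRC/RNE) | `0` for `1 ≤ N` (`gridAvg_probAwayC`); `−2^{-(D+1)}` for `N = 0 < D` (`gridAvg_probAwayC_zero_bits`) | `0` (`gridAvg_probAwayC_of_le`) |

and the paper's one-sided bounds for all `(N, D)` (`gridAvg_probAwayA_le`, `gridAvg_probAwayB_le`).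
[FitzgibbonFelix2025] App. A-C/A-D derive the `N ≤ D` column for A and B (with "≤" and a tightness
remark) and assert the C column in words (§III-F); the `D ≤ N` column, the `N = 0` row of C (zero
random bits = deterministic round-to-nearest-even, average bias `−2^{-(D+1)}` on every grid) and
the exactness are new here as kernel-checked statements.  Method (elementary): write the grid index
as `i = a·2^{D−N} + b`; then `x_i 2^N = a + b/2^{D−N}` and the three integer roundings are `a`,
`a + [2b ≥ 2^{D−N}]`, `a + [2b > 2^{D−N}] + [2b = 2^{D−N}]·[a odd]` (`floor_block`,
`floor_block_half`, `rnite_block`); sum over the blocks (`gridAvg_blocks`).  Pointwise (per-input)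
statements are stronger and live in files `SRLimitedBitsCounts` / `SRLimitedBits`; no claim about
any implementation.

## (3/3) `SRFewBitsDictionary.lean`
# Few-bit stochastic rounding: the Fitzgibbon–Felix modes SRFF / SRF / SRC ARE the P3109 modes
# A / B / C, and their finite-precision bias facts — proved, completed and corrected
# (venture file LXIX of the SR slice)

HONEST FRAMING: certified error envelopes and provably optimal rounding/accumulation schemes for
low-precision formats under stated cost models; every table by two implementations; no hardware
or vendor claims.

Venture CertifiedArithmetic / lowprec, SR slice.  [FitzgibbonFelix2025] (typed verbatim in
`Literature.ComputerArithmetic.FitzgibbonFelix2025`) defines few-bit SR by predicates on the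
residual `δ̃` and the random word `n < 2^N`.  This file proves:
* the DICTIONARY, for every residual and every random word (no range hypothesis):
  `R_SRFF(δ̃,n) ⟺ StochasticA_{N,n}(δ̃)`, `R_SRF ⟺ StochasticB`, `R_SRC` with round-to-nearest-even
  pre-rounding `⟺ StochasticC` (`rsrff_iff_stochasticA`, `rsrf_iff_stochasticB`,
  `rsrc_rnite_iff_stochasticC`); and `R_SRC` with round-half-up pre-rounding (Mathlib's `round`,
  = ties-away on `[0,1)`) is LITERALLY `R_SRF` (`rsrc_round_iff_rsrf`) — so "Round is any unbiased
  rounding scheme" in eq. (8) must exclude ties-away: that variant inherits SRF's grid bias;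
* hence the paper's pointwise / grid bias functionals are the away-probabilities of file
  `SRLimitedBitsCounts` minus the residual (`pointBias_rsrff/rsrf/rsrc`, `gridBias_rsrff/rsrf/rsrc`);
* ALL the paper's bias facts DISCHARGED (net named-fact debt of the typing file: 0):
  §III-C/A-A `bias_SRFF = −2^{-(N+1)}` and §III-D/A-B `bias_SRF = 0` over real residuals
  (`SRFFContBias_holds`, `SRFContBias_holds`: each random word rounds away on an interval of
  length `n2^{-N}` resp. `(n+½)2^{-N}`); from file LXVIII (`SRFewBitsGridBias`): App. A-C
  `bias_{SRFF,D} = (2^{-D} − 2^{-N})/2` for `N ≤ D` and `≤` always (`SRFFGridBias_holds`,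
  `SRFFGridBiasLe_holds`); App. A-D `bias_{SRF,D} = 2^{-(D+1)}` for `N < D` and `≤` always
  (`SRFGridBias_holds`, `SRFGridBiasLe_holds`); §III-F SRC unbiased on every grid for `1 ≤ N ≤ D`
  (`SRCGridBias_holds`, `src_gridBias_eq_zero` over any field) — the paper asserts the last in words; it is a theorem here;
* what the paper does not state: for `D ≤ N` all three modes have grid bias EXACTLY `0`
  (`srff_gridBias_of_le`, `srf_gridBias_of_le`, `src_gridBias_of_le`); with `N = 0` random bits
  SRC is round-to-nearest-even and its grid bias is `−2^{-(D+1)} ≠ 0` (`src_gridBias_zero_bits`),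
  so `1 ≤ N` in §III-F is necessary; SRC∘ties-away has grid bias `+2^{-(D+1)}` for `N < D`
  (`srcRound_gridBias`).
Per-input (pointwise) laws, which are strictly stronger than these averages, are files
`SRLimitedBitsCounts` / `SRLimitedBits` / `SRLimitedBitsOptimal`.  No claim about any implementation.
-/

noncomputable section

/-! ## (1/3) `SRLimitedBitsCounts.lean` -/

section

namespace Literature.ComputerArithmetic.FitzgibbonFelix2025.LimitedBits

open Literature.ComputerArithmetic.P3109
open Finset

variable {K : Type*} [Field K] [LinearOrder K] [IsStrictOrderedRing K] [FloorRing K]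

/-! ### Exact away-counts for `N` random bits -/

/-- Number of random words `R < 2^N` for which the mode rounds away from zero (`= 2^N · P(away)` for
uniformly distributed random bits).
[cite: FitzgibbonFelix2025, §II-B and §III (the per-word away events of SRFF / SRF / SRC; eq. (7), (8))] -/
def awayCount (mode : ℕ → ℕ → K → Prop) [∀ N R η, Decidable (mode N R η)] (N : ℕ) (η : K) : ℕ :=
  ((Finset.range (2 ^ N)).filter (fun R => mode N R η)).card

/-! ### Counting lemmas (elementary; proved) -/

omit [Field K] [LinearOrder K] [IsStrictOrderedRing K] [FloorRing K] in
/-- For `m ≤ t`, exactly `m` of the `R < t` satisfy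
`t ≤ m + R`.
[cite: FitzgibbonFelix2025, §II-B and §III (the per-word away events of SRFF / SRF / SRC; eq. (7), (8))] -/
theorem card_filter_threshold (t m : ℕ) (hm : m ≤ t) :
    ((Finset.range t).filter (fun R => t ≤ m + R)).card = m := by
  have : (Finset.range t).filter (fun R => t ≤ m + R) = Finset.Ico (t - m) t := by
    ext R
    simp only [Finset.mem_filter, Finset.mem_range, Finset.mem_Ico]
    omega
  rw [this, Nat.card_Ico]
  omega

omit [Field K] [LinearOrder K] [IsStrictOrderedRing K] [FloorRing K] in
/-- For `m < 2t`, exactly `⌊(m+1)/2⌋` of the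
`R < t` satisfy `2t ≤ m + (2R + 1)`.
[cite: FitzgibbonFelix2025, §II-B and §III (the per-word away events of SRFF / SRF / SRC; eq. (7), (8))] -/
theorem card_filter_threshold_odd (t m : ℕ) (hm : m < 2 * t) :
    ((Finset.range t).filter (fun R => 2 * t ≤ m + (2 * R + 1))).card = (m + 1) / 2 := by
  have : (Finset.range t).filter (fun R => 2 * t ≤ m + (2 * R + 1)) =
      Finset.Ico (t - (m + 1) / 2) t := by
    ext R
    simp only [Finset.mem_filter, Finset.mem_range, Finset.mem_Ico]
    omega
  rw [this, Nat.card_Ico]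
  omega

/-- The scaled fraction `η·2^N` has floor in `[0, 2^N)` when `0 ≤ η < 1`.
[cite: FitzgibbonFelix2025, §II-B and §III (the per-word away events of SRFF / SRF / SRC; eq. (7), (8))] -/
theorem floor_scaled_bounds {η : K} (h0 : 0 ≤ η) (h1 : η < 1) (N : ℕ) :
    0 ≤ ⌊η * 2 ^ N⌋ ∧ ⌊η * 2 ^ N⌋ < (2 : ℤ) ^ N := by
  refine ⟨Int.floor_nonneg.mpr (by positivity), ?_⟩
  rw [Int.floor_lt]
  have : η * 2 ^ N < 1 * 2 ^ N := by
    exact mul_lt_mul_of_pos_right h1 (by positivity)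
  push_cast
  linarith

/-- **StochasticA away-count**: for `0 ≤ η < 1`,
exactly `⌊η 2^N⌋` of the `2^N` random words round away from zero, i.e. `P_A(away) = ⌊η 2^N⌋ / 2^N`
(`≤ η`, deficit `< 2^{-N}`: biased towards zero).
[cite: FitzgibbonFelix2025, §II-B and §III (the per-word away events of SRFF / SRF / SRC; eq. (7), (8))] -/
theorem awayCount_stochasticA {η : K} (h0 : 0 ≤ η) (h1 : η < 1) (N : ℕ) :
    (awayCount StochasticA N η : ℤ) = ⌊η * 2 ^ N⌋ := by
  obtain ⟨hm0, hmt⟩ := floor_scaled_bounds h0 h1 N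
  set m : ℤ := ⌊η * 2 ^ N⌋ with hm
  have key : (Finset.range (2 ^ N)).filter (fun R => StochasticA N R η) =
      (Finset.range (2 ^ N)).filter (fun R => 2 ^ N ≤ m.toNat + R) := by
    apply Finset.filter_congr
    intro R _
    unfold StochasticA
    rw [← hm]
    have h2 : ((2 : ℤ) ^ N) = ((2 ^ N : ℕ) : ℤ) := by push_cast; ring
    constructor
    · intro h; zify; rw [Int.toNat_of_nonneg hm0]; rw [h2] at h; exact_mod_cast h
    · intro h; zify at h; rw [Int.toNat_of_nonneg hm0] at h; rw [h2]; exact_mod_cast h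
  unfold awayCount
  rw [key, card_filter_threshold]
  · exact Int.toNat_of_nonneg hm0
  · have : m.toNat < 2 ^ N := by
      have := Int.toNat_lt_toNat (by positivity : (0:ℤ) < 2 ^ N) |>.mpr hmt
      simpa using this
    exact this.le

/-- **StochasticB away-count**: for `0 ≤ η < 1`,
exactly `⌊(⌊η 2^(N+1)⌋ + 1)/2⌋` random words round away from zero.
[cite: FitzgibbonFelix2025, §II-B and §III (the per-word away events of SRFF / SRF / SRC; eq. (7), (8))] -/
theorem awayCount_stochasticB {η : K} (h0 : 0 ≤ η) (h1 : η < 1) (N : ℕ) :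
    (awayCount StochasticB N η : ℤ) = (⌊η * 2 ^ (N + 1)⌋ + 1) / 2 := by
  obtain ⟨hm0, hmt⟩ := floor_scaled_bounds h0 h1 (N + 1)
  set m : ℤ := ⌊η * 2 ^ (N + 1)⌋ with hm
  have key : (Finset.range (2 ^ N)).filter (fun R => StochasticB N R η) =
      (Finset.range (2 ^ N)).filter (fun R => 2 * 2 ^ N ≤ m.toNat + (2 * R + 1)) := by
    apply Finset.filter_congr
    intro R _
    unfold StochasticB
    rw [← hm]
    have h2 : ((2 : ℤ) ^ (N + 1)) = ((2 * 2 ^ N : ℕ) : ℤ) := by push_cast; ring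
    constructor
    · intro h; zify; rw [Int.toNat_of_nonneg hm0]; rw [h2] at h; exact_mod_cast h
    · intro h; zify at h; rw [Int.toNat_of_nonneg hm0] at h; rw [h2]; exact_mod_cast h
  unfold awayCount
  rw [key, card_filter_threshold_odd]
  · have := Int.toNat_of_nonneg hm0
    omega
  · have : m.toNat < 2 ^ (N + 1) := by
      have := Int.toNat_lt_toNat (by positivity : (0:ℤ) < 2 ^ (N + 1)) |>.mpr hmt
      simpa using this
    rw [pow_succ] at this
    omega

/-- The StochasticB count in closed form: `⌊(⌊2y⌋ + 1)/2⌋ = ⌊y + 1/2⌋` (`y = η 2^N`), so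
`P_B(away) = ⌊η 2^N + 1/2⌋ / 2^N` (within `2^{-(N+1)}` of `η`).
[cite: FitzgibbonFelix2025, §II-B and §III (the per-word away events of SRFF / SRF / SRC; eq. (7), (8))] -/
theorem floor_two_mul_add_one_div_two (y : K) : (⌊2 * y⌋ + 1) / 2 = ⌊y + 1 / 2⌋ := by
  have hk := Int.floor_le y
  have hk' := Int.lt_floor_add_one y
  set k : ℤ := ⌊y⌋
  by_cases hf : y < k + 1 / 2
  · have h2 : ⌊2 * y⌋ = 2 * k := by
      rw [Int.floor_eq_iff]; push_cast; constructor <;> linarith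
    have h3 : ⌊y + 1 / 2⌋ = k := by
      rw [Int.floor_eq_iff]; constructor <;> linarith
    rw [h2, h3]; omega
  · have hf : (k : K) + 1 / 2 ≤ y := not_lt.mp hf
    have h2 : ⌊2 * y⌋ = 2 * k + 1 := by
      rw [Int.floor_eq_iff]; push_cast; constructor <;> linarith
    have h3 : ⌊y + 1 / 2⌋ = k + 1 := by
      rw [Int.floor_eq_iff]; push_cast; constructor <;> linarith
    rw [h2, h3]; omega

/-- **StochasticB away-count, closed form**:
`awayCount B = ⌊η 2^N + 1/2⌋`.
[cite: FitzgibbonFelix2025, §II-B and §III (the per-word away events of SRFF / SRF / SRC; eq. (7), (8))] -/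
theorem awayCount_stochasticB' {η : K} (h0 : 0 ≤ η) (h1 : η < 1) (N : ℕ) :
    (awayCount StochasticB N η : ℤ) = ⌊η * 2 ^ N + 1 / 2⌋ := by
  rw [awayCount_stochasticB h0 h1 N, ← floor_two_mul_add_one_div_two]
  congr 2
  ring_nf

/-- `RNITE` is within `1/2` of its argument.
[cite: FitzgibbonFelix2025, §II-B and §III (the per-word away events of SRFF / SRF / SRC; eq. (7), (8))] -/
theorem abs_rnite_sub_le (X : K) : |(rnite X : K) - X| ≤ 1 / 2 := by
  have hk := Int.floor_le X
  have hk' := Int.lt_floor_add_one X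
  unfold rnite
  split_ifs with h1 h2 h3 <;> push_cast <;> rw [abs_le] <;> constructor <;> linarith

omit [IsStrictOrderedRing K] in
/-- `RNITE(X)` lies between `⌊X⌋` and `⌊X⌋ + 1`.
[cite: FitzgibbonFelix2025, §II-B and §III (the per-word away events of SRFF / SRF / SRC; eq. (7), (8))] -/
theorem floor_le_rnite (X : K) : ⌊X⌋ ≤ rnite X ∧ rnite X ≤ ⌊X⌋ + 1 := by
  unfold rnite
  split_ifs <;> constructor <;> omega

/-- **StochasticC away-count**: for `0 ≤ η < 1`,
exactly `RNITE(η 2^N)` random words round away from zero (`|RNITE(η2^N)/2^N − η| ≤ 2^{-(N+1)}`).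
[cite: FitzgibbonFelix2025, §II-B and §III (the per-word away events of SRFF / SRF / SRC; eq. (7), (8))] -/
theorem awayCount_stochasticC {η : K} (h0 : 0 ≤ η) (h1 : η < 1) (N : ℕ) :
    (awayCount StochasticC N η : ℤ) = rnite (η * 2 ^ N) := by
  obtain ⟨hm0, hmt⟩ := floor_scaled_bounds h0 h1 N
  obtain ⟨hr0, hr1⟩ := floor_le_rnite (η * 2 ^ N)
  set r : ℤ := rnite (η * 2 ^ N) with hr
  have hr0' : 0 ≤ r := hm0.trans hr0
  have hrt : r ≤ 2 ^ N := by omega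
  have key : (Finset.range (2 ^ N)).filter (fun R => StochasticC N R η) =
      (Finset.range (2 ^ N)).filter (fun R => 2 ^ N ≤ r.toNat + R) := by
    apply Finset.filter_congr
    intro R _
    unfold StochasticC
    rw [← hr]
    have h2 : ((2 : ℤ) ^ N) = ((2 ^ N : ℕ) : ℤ) := by push_cast; ring
    constructor
    · intro h; zify; rw [Int.toNat_of_nonneg hr0']; rw [h2] at h; exact_mod_cast h
    · intro h; zify at h; rw [Int.toNat_of_nonneg hr0'] at h; rw [h2]; exact_mod_cast h
  unfold awayCount
  rw [key, card_filter_threshold]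
  · exact Int.toNat_of_nonneg hr0'
  · have : (r.toNat : ℤ) ≤ 2 ^ N := by rw [Int.toNat_of_nonneg hr0']; exact hrt
    exact_mod_cast this


/-! ### Away-probabilities and their deviation from exact SR -/

/-- `P_A(away) = ⌊η 2^N⌋ / 2^N`.
[cite: FitzgibbonFelix2025, §II-B and §III (the per-word away events of SRFF / SRF / SRC; eq. (7), (8))] -/
def probAwayA (N : ℕ) (η : K) : K := (⌊η * 2 ^ N⌋ : K) / 2 ^ N

/-- `P_B(away) = ⌊η 2^N + 1/2⌋ / 2^N`.
[cite: FitzgibbonFelix2025, §II-B and §III (the per-word away events of SRFF / SRF / SRC; eq. (7), (8))] -/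
def probAwayB (N : ℕ) (η : K) : K := (⌊η * 2 ^ N + 1 / 2⌋ : K) / 2 ^ N

/-- `P_C(away) = RNITE(η 2^N) / 2^N`.
[cite: FitzgibbonFelix2025, §II-B and §III (the per-word away events of SRFF / SRF / SRC; eq. (7), (8))] -/
def probAwayC (N : ℕ) (η : K) : K := (rnite (η * 2 ^ N) : K) / 2 ^ N

/-- The away-count of StochasticA divided by `2^N` is `probAwayA`.
[cite: FitzgibbonFelix2025, §II-B and §III (the per-word away events of SRFF / SRF / SRC; eq. (7), (8))] -/
theorem awayCount_stochasticA_div {η : K} (h0 : 0 ≤ η) (h1 : η < 1) (N : ℕ) :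
    (awayCount StochasticA N η : K) / 2 ^ N = probAwayA N η := by
  unfold probAwayA; congr 1; exact_mod_cast awayCount_stochasticA h0 h1 N

/-- The away-count of StochasticB divided by `2^N` is `probAwayB`.
[cite: FitzgibbonFelix2025, §II-B and §III (the per-word away events of SRFF / SRF / SRC; eq. (7), (8))] -/
theorem awayCount_stochasticB_div {η : K} (h0 : 0 ≤ η) (h1 : η < 1) (N : ℕ) :
    (awayCount StochasticB N η : K) / 2 ^ N = probAwayB N η := by
  unfold probAwayB; congr 1; exact_mod_cast awayCount_stochasticB' h0 h1 N

/-- The away-count of StochasticC divided by `2^N` is `probAwayC`.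
[cite: FitzgibbonFelix2025, §II-B and §III (the per-word away events of SRFF / SRF / SRC; eq. (7), (8))] -/
theorem awayCount_stochasticC_div {η : K} (h0 : 0 ≤ η) (h1 : η < 1) (N : ℕ) :
    (awayCount StochasticC N η : K) / 2 ^ N = probAwayC N η := by
  unfold probAwayC; congr 1; exact_mod_cast awayCount_stochasticC h0 h1 N

/-- StochasticA never rounds away more often than exact SR: `P_A(away) ≤ η`.
[cite: FitzgibbonFelix2025, §II-B and §III (the per-word away events of SRFF / SRF / SRC; eq. (7), (8))] -/
theorem probAwayA_le (N : ℕ) (η : K) : probAwayA N η ≤ η := by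
  unfold probAwayA
  rw [div_le_iff₀ (by positivity)]
  exact Int.floor_le _

/-- ... and the deficit is `< 2^{-N}`: `η − 2^{-N} < P_A(away)`.
[cite: FitzgibbonFelix2025, §II-B and §III (the per-word away events of SRFF / SRF / SRC; eq. (7), (8))] -/
theorem sub_lt_probAwayA (N : ℕ) (η : K) : η - 1 / 2 ^ N < probAwayA N η := by
  unfold probAwayA
  have h := Int.lt_floor_add_one (η * 2 ^ N)
  have h2 : (0 : K) < 2 ^ N := by positivity
  rw [sub_lt_iff_lt_add, ← add_div, lt_div_iff₀ h2]
  linarith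

/-- `|P_A(away) − η| ≤ 2^{-N}` on `[0,1]` (indeed `< 2^{-N}`, one-sided).
[cite: FitzgibbonFelix2025, §II-B and §III (the per-word away events of SRFF / SRF / SRC; eq. (7), (8))] -/
theorem abs_probAwayA_sub_le (N : ℕ) (η : K) : |probAwayA N η - η| ≤ 1 / 2 ^ N := by
  rw [abs_le]; constructor <;> linarith [probAwayA_le N η, sub_lt_probAwayA N η]

/-- `|P_B(away) − η| ≤ 2^{-(N+1)}`.
[cite: FitzgibbonFelix2025, §II-B and §III (the per-word away events of SRFF / SRF / SRC; eq. (7), (8))] -/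
theorem abs_probAwayB_sub_le (N : ℕ) (η : K) : |probAwayB N η - η| ≤ 1 / 2 ^ (N + 1) := by
  unfold probAwayB
  have h := Int.floor_le (η * 2 ^ N + 1 / 2)
  have h' := Int.lt_floor_add_one (η * 2 ^ N + 1 / 2)
  have h2 : (0 : K) < 2 ^ N := by positivity
  rw [abs_le]; constructor
  · rw [show -(1 / (2:K) ^ (N + 1)) = (η * 2 ^ N - 1 / 2) / 2 ^ N - η by field_simp; ring]
    rw [sub_le_sub_iff_right, div_le_div_iff_of_pos_right h2]; linarith
  · rw [show (1 / (2:K) ^ (N + 1)) = (η * 2 ^ N + 1 / 2) / 2 ^ N - η by field_simp; ring]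
    rw [sub_le_sub_iff_right, div_le_div_iff_of_pos_right h2]; exact h

/-- `|P_C(away) − η| ≤ 2^{-(N+1)}`.
[cite: FitzgibbonFelix2025, §II-B and §III (the per-word away events of SRFF / SRF / SRC; eq. (7), (8))] -/
theorem abs_probAwayC_sub_le (N : ℕ) (η : K) : |probAwayC N η - η| ≤ 1 / 2 ^ (N + 1) := by
  unfold probAwayC
  have h := abs_rnite_sub_le (η * 2 ^ N)
  have h2 : (0 : K) < 2 ^ N := by positivity
  rw [show (rnite (η * 2 ^ N) : K) / 2 ^ N - η = ((rnite (η * 2 ^ N) : K) - η * 2 ^ N) / 2 ^ N by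
    field_simp]
  rw [abs_div, abs_of_pos h2, div_le_iff₀ h2]
  rw [show (1:K) / 2 ^ (N + 1) * 2 ^ N = 1 / 2 by field_simp; ring]
  exact h


/-! ### The three P3109 rules as instances -/

/-- `probAwayA` maps `[0,1]` into `[0,1]`.
[cite: FitzgibbonFelix2025, §II-B and §III (the per-word away events of SRFF / SRF / SRC; eq. (7), (8))] -/
theorem probAwayA_mem (N : ℕ) (η : K) (h0 : 0 ≤ η) (h1 : η ≤ 1) :
    0 ≤ probAwayA N η ∧ probAwayA N η ≤ 1 := by
  refine ⟨?_, (probAwayA_le N η).trans h1⟩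
  unfold probAwayA
  exact div_nonneg (by exact_mod_cast Int.floor_nonneg.mpr (by positivity)) (by positivity)

/-- `probAwayB` maps `[0,1]` into `[0,1]`.
[cite: FitzgibbonFelix2025, §II-B and §III (the per-word away events of SRFF / SRF / SRC; eq. (7), (8))] -/
theorem probAwayB_mem (N : ℕ) (η : K) (h0 : 0 ≤ η) (h1 : η ≤ 1) :
    0 ≤ probAwayB N η ∧ probAwayB N η ≤ 1 := by
  unfold probAwayB
  have h2 : (0 : K) < 2 ^ N := by positivity
  constructor
  · exact div_nonneg (by exact_mod_cast Int.floor_nonneg.mpr (by positivity)) h2.le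
  · rw [div_le_one h2]
    have : ⌊η * 2 ^ N + 1 / 2⌋ ≤ ((2 ^ N : ℕ) : ℤ) := by
      rw [Int.floor_le_iff]; push_cast; nlinarith
    exact_mod_cast this

/-- `probAwayC` maps `[0,1]` into `[0,1]`.
[cite: FitzgibbonFelix2025, §II-B and §III (the per-word away events of SRFF / SRF / SRC; eq. (7), (8))] -/
theorem probAwayC_mem (N : ℕ) (η : K) (h0 : 0 ≤ η) (h1 : η ≤ 1) :
    0 ≤ probAwayC N η ∧ probAwayC N η ≤ 1 := by
  unfold probAwayC
  have h2 : (0 : K) < 2 ^ N := by positivity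
  obtain ⟨hr0, hr1⟩ := floor_le_rnite (η * 2 ^ N)
  have hf0 : 0 ≤ ⌊η * 2 ^ N⌋ := Int.floor_nonneg.mpr (by positivity)
  constructor
  · exact div_nonneg (by exact_mod_cast hf0.trans hr0) h2.le
  · rw [div_le_one h2]
    -- rnite X ≤ X + 1/2 ≤ 2^N + 1/2, and rnite X is an integer; sharper: use |rnite X - X| ≤ 1/2
    have hab := abs_rnite_sub_le (η * 2 ^ N)
    rw [abs_le] at hab
    have hX : η * 2 ^ N ≤ 2 ^ N := by nlinarith
    -- rnite ≤ 2^N + 1/2 and integer ⇒ ≤ 2^N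
    have hlt : (rnite (η * 2 ^ N) : K) < (2 ^ N : ℕ) + 1 := by push_cast; linarith
    have : rnite (η * 2 ^ N) < ((2 ^ N : ℕ) : ℤ) + 1 := by exact_mod_cast hlt
    have : rnite (η * 2 ^ N) ≤ ((2 ^ N : ℕ) : ℤ) := by omega
    exact_mod_cast this

end Literature.ComputerArithmetic.FitzgibbonFelix2025.LimitedBits

end

/-! ## (2/3) `SRFewBitsGridBias.lean` -/

section

namespace Literature.ComputerArithmetic.FitzgibbonFelix2025.LimitedBits

open Literature.ComputerArithmetic.P3109
open Finset

variable {K : Type*} [Field K] [LinearOrder K] [IsStrictOrderedRing K] [FloorRing K]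

/-! ### Block decomposition and elementary sums -/

omit [LinearOrder K] [IsStrictOrderedRing K] [FloorRing K] in
/-- `Σ_{i < B·k} f(i) = Σ_{a<B} Σ_{b<k} f(a k + b)`.
[cite: FitzgibbonFelix2025, §III-E eq. (7), App. A-C / A-D (input-averaged bias on the grid 2^(−D)ℤ ∩ [0,1))] -/
theorem sum_range_mul_blocks (f : ℕ → K) (B k : ℕ) :
    ∑ i ∈ range (B * k), f i = ∑ a ∈ range B, ∑ b ∈ range k, f (a * k + b) := by
  induction B with
  | zero => simp
  | succ B ih => rw [Nat.succ_mul, sum_range_add, ih, sum_range_succ]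

omit [FloorRing K] in
/-- Gauss: `Σ_{i<n} i = n(n−1)/2` (cast to `K`).
[cite: FitzgibbonFelix2025, §III-E eq. (7), App. A-C / A-D (input-averaged bias on the grid 2^(−D)ℤ ∩ [0,1))] -/
theorem sum_range_natCast (n : ℕ) : ∑ i ∈ range n, (i : K) = (n : K) * ((n : K) - 1) / 2 := by
  induction n with
  | zero => simp
  | succ n ih => rw [sum_range_succ, ih]; push_cast; field_simp; ring

omit [LinearOrder K] [IsStrictOrderedRing K] [FloorRing K] in
/-- `#{b < 2h : 2h ≤ 2b} = h`, as a sum of indicators.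
[cite: FitzgibbonFelix2025, §III-E eq. (7), App. A-C / A-D (input-averaged bias on the grid 2^(−D)ℤ ∩ [0,1))] -/
theorem sum_ite_half_le (h : ℕ) :
    ∑ b ∈ range (2 * h), (if 2 * h ≤ 2 * b then (1 : K) else 0) = h := by
  rw [Finset.sum_boole]
  have : (range (2 * h)).filter (fun b => 2 * h ≤ 2 * b) = Ico h (2 * h) := by
    ext b; simp only [mem_filter, mem_range, mem_Ico]; omega
  rw [this, Nat.card_Ico, show 2 * h - h = h by omega]

omit [LinearOrder K] [IsStrictOrderedRing K] [FloorRing K] in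
/-- The RNITE extra count on one block of even length `2h ≥ 2`:
`Σ_{b<2h} ([2b > 2h] + t·[2b = 2h]) = (h − 1) + t`.
[cite: FitzgibbonFelix2025, §III-E eq. (7), App. A-C / A-D (input-averaged bias on the grid 2^(−D)ℤ ∩ [0,1))] -/
theorem sum_ite_rnite_extra (h : ℕ) (hh : 1 ≤ h) (t : K) :
    ∑ b ∈ range (2 * h), (if 2 * b < 2 * h then (0 : K) else if 2 * h < 2 * b then 1 else t)
      = (h : K) - 1 + t := by
  have hsplit : ∀ b ∈ range (2 * h),
      (if 2 * b < 2 * h then (0 : K) else if 2 * h < 2 * b then 1 else t)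
        = (if h < b then (1 : K) else 0) + (if h = b then t else 0) := by
    intro b _
    by_cases h1 : 2 * b < 2 * h
    · rw [if_pos h1, if_neg (by omega), if_neg (by omega)]; ring
    · rw [if_neg h1]
      by_cases h2 : 2 * h < 2 * b
      · rw [if_pos h2, if_pos (by omega), if_neg (by omega)]; ring
      · rw [if_neg h2, if_neg (by omega), if_pos (by omega)]; ring
  rw [sum_congr rfl hsplit, sum_add_distrib, Finset.sum_boole, sum_ite_eq]
  have : (range (2 * h)).filter (fun b => h < b) = Ico (h + 1) (2 * h) := by
    ext b; simp only [mem_filter, mem_range, mem_Ico]; omega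
  rw [this, Nat.card_Ico, if_pos (mem_range.2 (by omega)), Nat.cast_sub (by omega)]
  push_cast; ring

omit [LinearOrder K] [IsStrictOrderedRing K] [FloorRing K] in
/-- Half of the numbers below `2m` are odd: `Σ_{a<2m} [a odd] = m`.
[cite: FitzgibbonFelix2025, §III-E eq. (7), App. A-C / A-D (input-averaged bias on the grid 2^(−D)ℤ ∩ [0,1))] -/
theorem sum_ite_odd (m : ℕ) : ∑ a ∈ range (2 * m), (if Odd a then (1 : K) else 0) = m := by
  induction m with
  | zero => simp
  | succ m ih =>
    rw [show 2 * (m + 1) = 2 * m + 1 + 1 by ring, sum_range_succ, sum_range_succ, ih,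
      if_neg (Nat.not_odd_iff_even.2 (even_two_mul m)), if_pos (odd_two_mul_add_one m)]
    push_cast; ring

/-! ### The three integer roundings on a block -/

/-- `⌊(a k + b)/k⌋ = a` for `b < k`.
[cite: FitzgibbonFelix2025, §III-E eq. (7), App. A-C / A-D (input-averaged bias on the grid 2^(−D)ℤ ∩ [0,1))] -/
theorem floor_block (a b k : ℕ) (hb : b < k) : ⌊((a * k + b : ℕ) : K) / k⌋ = a := by
  have hk : (0 : K) < k := by exact_mod_cast (show 0 < k by omega)
  have hbk : (b : K) < k := by exact_mod_cast hb
  rw [Int.floor_eq_iff]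
  push_cast
  refine ⟨?_, ?_⟩
  · rw [le_div_iff₀ hk]
    have : (0 : K) ≤ b := by positivity
    linarith
  · rw [div_lt_iff₀ hk]; nlinarith

/-- `⌊(a k + b)/k + ½⌋ = a + [k ≤ 2b]` for `b < k`.
[cite: FitzgibbonFelix2025, §III-E eq. (7), App. A-C / A-D (input-averaged bias on the grid 2^(−D)ℤ ∩ [0,1))] -/
theorem floor_block_half (a b k : ℕ) (hb : b < k) :
    ⌊((a * k + b : ℕ) : K) / k + 1 / 2⌋ = a + if k ≤ 2 * b then 1 else 0 := by
  have hk : (0 : K) < k := by exact_mod_cast (show 0 < k by omega)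
  have hbk : (b : K) < k := by exact_mod_cast hb
  have e : ((a * k + b : ℕ) : K) / k = a + b / k := by
    push_cast; field_simp
  rw [e, Int.floor_eq_iff]
  split_ifs with h
  · have h' : (k : K) ≤ 2 * b := by exact_mod_cast h
    have h1 : (1 : K) / 2 ≤ b / k := by rw [div_le_div_iff₀ (by norm_num) hk]; linarith
    have h2 : (b : K) / k < 1 := by rw [div_lt_one hk]; exact hbk
    push_cast
    constructor <;> linarith
  · have h' : 2 * (b : K) < k := by exact_mod_cast (show 2 * b < k by omega)
    have h1 : (0 : K) ≤ b / k := by positivity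
    have h2 : (b : K) / k < 1 / 2 := by rw [div_lt_div_iff₀ hk (by norm_num)]; linarith
    push_cast
    constructor <;> linarith

/-- `RNITE((a k + b)/k) = a + [2b > k] + [2b = k]·[a odd]` for `b < k`.
[cite: FitzgibbonFelix2025, §III-E eq. (7), App. A-C / A-D (input-averaged bias on the grid 2^(−D)ℤ ∩ [0,1))] -/
theorem rnite_block (a b k : ℕ) (hb : b < k) :
    rnite (((a * k + b : ℕ) : K) / k)
      = a + if 2 * b < k then 0 else if k < 2 * b then 1 else if Odd a then 1 else 0 := by
  have hk : (0 : K) < k := by exact_mod_cast (show 0 < k by omega)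
  have hfl := floor_block (K := K) a b k hb
  have e : ((a * k + b : ℕ) : K) / k = a + b / k := by
    push_cast; field_simp
  unfold rnite
  rw [hfl, e]
  by_cases h1 : 2 * b < k
  · have h' : 2 * (b : K) < k := by exact_mod_cast h1
    have : (b : K) / k < 1 / 2 := by rw [div_lt_div_iff₀ hk (by norm_num)]; linarith
    rw [if_pos (by push_cast; linarith), if_pos h1]; simp
  · rw [if_neg h1]
    by_cases h2 : k < 2 * b
    · have h' : (k : K) < 2 * b := by exact_mod_cast h2
      have : (1 : K) / 2 < b / k := by rw [div_lt_div_iff₀ (by norm_num) hk]; linarith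
      rw [if_neg (by push_cast; linarith), if_pos (by push_cast; linarith), if_pos h2]
    · have h' : 2 * (b : K) = k := by exact_mod_cast (show 2 * b = k by omega)
      have : (b : K) / k = 1 / 2 := by rw [div_eq_div_iff (ne_of_gt hk) (by norm_num)]; linarith
      rw [if_neg (by push_cast; linarith), if_neg (by push_cast; linarith), if_neg h2]
      simp [Int.odd_coe_nat]

/-! ### Generic block summation of a grid average -/

omit [FloorRing K] in
/-- Scaling a grid residual by `2^N`: `(i / 2^{N+j}) · 2^N = i / 2^j`.
[cite: FitzgibbonFelix2025, §III-E eq. (7), App. A-C / A-D (input-averaged bias on the grid 2^(−D)ℤ ∩ [0,1))] -/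
theorem grid_scale (N j i : ℕ) : ((i : K) / 2 ^ (N + j)) * 2 ^ N = (i : K) / ((2 ^ j : ℕ) : K) := by
  push_cast; rw [pow_add]; field_simp

omit [FloorRing K] in
/-- **Block summation.**  If an integer rounding `c` of `x_i 2^N`, on the block `i = a 2^j + b`
(`b < 2^j`, `D = N + j`), equals `a + e(a,b)`, then the grid average of `c/2^N − x` is
`(2^{-D} − 2^{-N})/2 + (Σ_a Σ_b e)/(2^N 2^D)`.
[cite: FitzgibbonFelix2025, §III-E eq. (7), App. A-C / A-D (input-averaged bias on the grid 2^(−D)ℤ ∩ [0,1))] -/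
theorem gridAvg_blocks (N j : ℕ) (c : K → ℤ) (e : ℕ → ℕ → K)
    (hc : ∀ a b : ℕ, b < 2 ^ j →
      ((c ((((a * 2 ^ j + b : ℕ) : K) / 2 ^ (N + j)) * 2 ^ N) : ℤ) : K) = a + e a b) :
    (∑ i ∈ range (2 ^ (N + j)), (((c (((i : K) / 2 ^ (N + j)) * 2 ^ N) : ℤ) : K) / 2 ^ N
        - (i : K) / 2 ^ (N + j))) / 2 ^ (N + j)
      = (1 / 2 ^ (N + j) - 1 / 2 ^ N) / 2
        + (∑ a ∈ range (2 ^ N), ∑ b ∈ range (2 ^ j), e a b) / (2 ^ N * 2 ^ (N + j)) := by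
  have hx : ∑ i ∈ range (2 ^ (N + j)), ((i : K) / 2 ^ (N + j)) = ((2 : K) ^ (N + j) - 1) / 2 := by
    rw [← Finset.sum_div, sum_range_natCast]; push_cast; field_simp
  have hcs : ∑ i ∈ range (2 ^ (N + j)), (((c (((i : K) / 2 ^ (N + j)) * 2 ^ N) : ℤ) : K))
      = (2 : K) ^ j * (2 ^ N * (2 ^ N - 1) / 2)
        + ∑ a ∈ range (2 ^ N), ∑ b ∈ range (2 ^ j), e a b := by
    rw [pow_add, sum_range_mul_blocks]
    rw [sum_congr rfl (fun a _ => sum_congr rfl (fun b hb => hc a b (mem_range.1 hb)))]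
    simp only [sum_add_distrib, sum_const, card_range, nsmul_eq_mul]
    rw [← Finset.mul_sum, sum_range_natCast]; push_cast; ring
  rw [sum_sub_distrib, ← Finset.sum_div, hcs, hx]
  field_simp
  ring

omit [FloorRing K] in
/-- **Resolved regime.**  If `D ≤ N` (`N = D + j`) every grid residual times `2^N` is an integer;
an integer rounding `c` fixing integers then has grid average bias `0`.
[cite: FitzgibbonFelix2025, §III-E eq. (7), App. A-C / A-D (input-averaged bias on the grid 2^(−D)ℤ ∩ [0,1))] -/
theorem gridAvg_resolved (D j : ℕ) (c : K → ℤ) (hc : ∀ m : ℕ, c (m : K) = m) :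
    (∑ i ∈ range (2 ^ D), (((c (((i : K) / 2 ^ D) * 2 ^ (D + j)) : ℤ) : K) / 2 ^ (D + j)
        - (i : K) / 2 ^ D)) / 2 ^ D = 0 := by
  have hz : ∀ i ∈ range (2 ^ D), ((c (((i : K) / 2 ^ D) * 2 ^ (D + j)) : ℤ) : K) / 2 ^ (D + j)
      - (i : K) / 2 ^ D = 0 := by
    intro i _
    have e : ((i : K) / 2 ^ D) * 2 ^ (D + j) = ((i * 2 ^ j : ℕ) : K) := by
      push_cast; rw [pow_add]; field_simp
    rw [e, hc]; push_cast; rw [pow_add]; field_simp; ring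
  rw [sum_congr rfl hz]; simp

/-! ### Mode A (= SRFF = `SR_{p,r}`): exact grid-averaged bias -/

/-- **Mode A, `N ≤ D`**: `2^{-D} Σ_i (P_A(x_i) − x_i) = (2^{-D} − 2^{-N})/2 = −(2^{-N} − 2^{-D})/2`
([FitzgibbonFelix2025] App. A-C, there with "≤" and "tight for `N ≤ D`"; exact here).
[cite: FitzgibbonFelix2025, §III-E eq. (7), App. A-C / A-D (input-averaged bias on the grid 2^(−D)ℤ ∩ [0,1))] -/
theorem gridAvg_probAwayA {N D : ℕ} (hND : N ≤ D) :
    (∑ i ∈ range (2 ^ D), (probAwayA N ((i : K) / 2 ^ D) - (i : K) / 2 ^ D)) / 2 ^ D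
      = (1 / 2 ^ D - 1 / 2 ^ N) / 2 := by
  obtain ⟨j, rfl⟩ := Nat.exists_eq_add_of_le hND
  unfold probAwayA
  have h := gridAvg_blocks (K := K) N j (fun y => ⌊y⌋) (fun _ _ => 0) (fun a b hb => by
    rw [grid_scale, floor_block a b _ hb]; simp)
  simpa using h

/-- **Mode A, `D ≤ N`**: the random bits resolve every grid residual, `P_A(x_i) = x_i`, average
bias `0`.
[cite: FitzgibbonFelix2025, §III-E eq. (7), App. A-C / A-D (input-averaged bias on the grid 2^(−D)ℤ ∩ [0,1))] -/
theorem gridAvg_probAwayA_of_le {N D : ℕ} (hDN : D ≤ N) :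
    (∑ i ∈ range (2 ^ D), (probAwayA N ((i : K) / 2 ^ D) - (i : K) / 2 ^ D)) / 2 ^ D = 0 := by
  obtain ⟨j, rfl⟩ := Nat.exists_eq_add_of_le hDN
  unfold probAwayA
  exact gridAvg_resolved (K := K) D j (fun y => ⌊y⌋) (fun m => Int.floor_natCast m)

/-- **Mode A, all `(N, D)`**: the one-sided bound `≤ (2^{-D} − 2^{-N})/2` of
[FitzgibbonFelix2025] App. A-C.
[cite: FitzgibbonFelix2025, §III-E eq. (7), App. A-C / A-D (input-averaged bias on the grid 2^(−D)ℤ ∩ [0,1))] -/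
theorem gridAvg_probAwayA_le (N D : ℕ) :
    (∑ i ∈ range (2 ^ D), (probAwayA N ((i : K) / 2 ^ D) - (i : K) / 2 ^ D)) / 2 ^ D
      ≤ (1 / 2 ^ D - 1 / 2 ^ N) / 2 := by
  rcases le_total N D with h | h
  · exact (gridAvg_probAwayA h).le
  · rw [gridAvg_probAwayA_of_le h]
    have : (1 : K) / 2 ^ N ≤ 1 / 2 ^ D :=
      one_div_le_one_div_of_le (by positivity) (pow_le_pow_right₀ (by norm_num) h)
    linarith

/-! ### Mode B (= SRF): exact grid-averaged bias -/

/-- **Mode B, `N < D`**: `2^{-D} Σ_i (P_B(x_i) − x_i) = 2^{-(D+1)}` — independent of `N`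
([FitzgibbonFelix2025] App. A-D; exact here).  SRF, unbiased over real inputs, is biased UP on
every finite input grid it does not resolve.
[cite: FitzgibbonFelix2025, §III-E eq. (7), App. A-C / A-D (input-averaged bias on the grid 2^(−D)ℤ ∩ [0,1))] -/
theorem gridAvg_probAwayB {N D : ℕ} (hND : N < D) :
    (∑ i ∈ range (2 ^ D), (probAwayB N ((i : K) / 2 ^ D) - (i : K) / 2 ^ D)) / 2 ^ D
      = 1 / 2 ^ (D + 1) := by
  obtain ⟨j, rfl⟩ := Nat.exists_eq_add_of_le hND
  rw [show N + 1 + j = N + (j + 1) by ring]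
  unfold probAwayB
  have h := gridAvg_blocks (K := K) N (j + 1) (fun y => ⌊y + 1 / 2⌋)
    (fun _ b => if 2 ^ (j + 1) ≤ 2 * b then 1 else 0) (fun a b hb => by
      rw [grid_scale, floor_block_half a b _ hb]; push_cast; rfl)
  rw [h]
  have hs : ∑ a ∈ range (2 ^ N), ∑ b ∈ range (2 ^ (j + 1)),
      (if 2 ^ (j + 1) ≤ 2 * b then (1 : K) else 0) = 2 ^ N * 2 ^ j := by
    rw [show (2 : ℕ) ^ (j + 1) = 2 * 2 ^ j by ring, sum_const, card_range, sum_ite_half_le,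
      nsmul_eq_mul]
    push_cast; ring
  rw [hs]; field_simp; ring

/-- **Mode B, `D ≤ N`**: resolved residuals, average bias `0`.
[cite: FitzgibbonFelix2025, §III-E eq. (7), App. A-C / A-D (input-averaged bias on the grid 2^(−D)ℤ ∩ [0,1))] -/
theorem gridAvg_probAwayB_of_le {N D : ℕ} (hDN : D ≤ N) :
    (∑ i ∈ range (2 ^ D), (probAwayB N ((i : K) / 2 ^ D) - (i : K) / 2 ^ D)) / 2 ^ D = 0 := by
  obtain ⟨j, rfl⟩ := Nat.exists_eq_add_of_le hDN
  unfold probAwayB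
  refine gridAvg_resolved (K := K) D j (fun y => ⌊y + 1 / 2⌋) (fun m => ?_)
  have h12 : ⌊(1 / 2 : K)⌋ = 0 := Int.floor_eq_iff.2 ⟨by norm_num, by norm_num⟩
  show ⌊(m : K) + 1 / 2⌋ = m
  rw [Int.floor_natCast_add, h12, add_zero]

/-- **Mode B, all `(N, D)`**: the one-sided bound `≤ 2^{-(D+1)}` of [FitzgibbonFelix2025]
App. A-D.
[cite: FitzgibbonFelix2025, §III-E eq. (7), App. A-C / A-D (input-averaged bias on the grid 2^(−D)ℤ ∩ [0,1))] -/
theorem gridAvg_probAwayB_le (N D : ℕ) :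
    (∑ i ∈ range (2 ^ D), (probAwayB N ((i : K) / 2 ^ D) - (i : K) / 2 ^ D)) / 2 ^ D
      ≤ 1 / 2 ^ (D + 1) := by
  rcases lt_or_ge N D with h | h
  · exact (gridAvg_probAwayB h).le
  · rw [gridAvg_probAwayB_of_le h]; positivity

/-! ### Mode C (= SRC with round-to-nearest-even): exact grid-averaged bias -/

/-- **Mode C, `1 ≤ N < D`**: `2^{-D} Σ_i (P_C(x_i) − x_i) = 0` — the ties-to-even pre-rounding
makes few-bit SR unbiased ON AVERAGE over every input grid ([FitzgibbonFelix2025] §III-F, asserted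
there; proved here).  Pointwise it is biased by up to `2^{-(N+1)}` (`abs_probAwayC_sub_le`).
[cite: FitzgibbonFelix2025, §III-E eq. (7), App. A-C / A-D (input-averaged bias on the grid 2^(−D)ℤ ∩ [0,1))] -/
theorem gridAvg_probAwayC {N D : ℕ} (h1 : 1 ≤ N) (hND : N < D) :
    (∑ i ∈ range (2 ^ D), (probAwayC N ((i : K) / 2 ^ D) - (i : K) / 2 ^ D)) / 2 ^ D = 0 := by
  obtain ⟨j, rfl⟩ := Nat.exists_eq_add_of_le hND
  rw [show N + 1 + j = N + (j + 1) by ring]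
  unfold probAwayC
  have h := gridAvg_blocks (K := K) N (j + 1) (fun y => rnite y)
    (fun a b => if 2 * b < 2 ^ (j + 1) then 0 else if 2 ^ (j + 1) < 2 * b then 1
      else if Odd a then 1 else 0) (fun a b hb => by
      rw [grid_scale, rnite_block a b _ hb]; push_cast; rfl)
  rw [h]
  obtain ⟨m, rfl⟩ : ∃ m, N = m + 1 := ⟨N - 1, by omega⟩
  have hs : ∑ a ∈ range (2 ^ (m + 1)), ∑ b ∈ range (2 ^ (j + 1)),
      (if 2 * b < 2 ^ (j + 1) then (0 : K) else if 2 ^ (j + 1) < 2 * b then 1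
        else if Odd a then 1 else 0) = 2 ^ (m + 1) * (2 ^ j - 1) + 2 ^ m := by
    rw [show (2 : ℕ) ^ (j + 1) = 2 * 2 ^ j by ring]
    rw [sum_congr rfl (fun a _ => sum_ite_rnite_extra (2 ^ j) Nat.one_le_two_pow _)]
    rw [sum_add_distrib, sum_const, card_range, nsmul_eq_mul,
      show (2 : ℕ) ^ (m + 1) = 2 * 2 ^ m by ring, sum_ite_odd]
    push_cast; ring
  rw [hs]; field_simp; ring

/-- **Mode C, `D ≤ N`**: resolved residuals, average bias `0`.
[cite: FitzgibbonFelix2025, §III-E eq. (7), App. A-C / A-D (input-averaged bias on the grid 2^(−D)ℤ ∩ [0,1))] -/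
theorem gridAvg_probAwayC_of_le {N D : ℕ} (hDN : D ≤ N) :
    (∑ i ∈ range (2 ^ D), (probAwayC N ((i : K) / 2 ^ D) - (i : K) / 2 ^ D)) / 2 ^ D = 0 := by
  obtain ⟨j, rfl⟩ := Nat.exists_eq_add_of_le hDN
  unfold probAwayC
  refine gridAvg_resolved (K := K) D j (fun y => rnite y) (fun m => ?_)
  unfold rnite
  rw [Int.floor_natCast, if_pos (by push_cast; linarith)]

/-- **Mode C with ZERO random bits is round-to-nearest-even**, whose average bias on a grid with
`D ≥ 1` excess bits is `−2^{-(D+1)}` (the single tie `x = ½` goes to the even side `0`): the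
hypothesis `1 ≤ N` in `gridAvg_probAwayC` is necessary.
[cite: FitzgibbonFelix2025, §III-E eq. (7), App. A-C / A-D (input-averaged bias on the grid 2^(−D)ℤ ∩ [0,1))] -/
theorem gridAvg_probAwayC_zero_bits {D : ℕ} (hD : 1 ≤ D) :
    (∑ i ∈ range (2 ^ D), (probAwayC 0 ((i : K) / 2 ^ D) - (i : K) / 2 ^ D)) / 2 ^ D
      = -(1 / 2 ^ (D + 1)) := by
  obtain ⟨j, rfl⟩ := Nat.exists_eq_add_of_le hD
  rw [show 1 + j = 0 + (j + 1) by ring]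
  unfold probAwayC
  have h := gridAvg_blocks (K := K) 0 (j + 1) (fun y => rnite y)
    (fun a b => if 2 * b < 2 ^ (j + 1) then 0 else if 2 ^ (j + 1) < 2 * b then 1
      else if Odd a then 1 else 0) (fun a b hb => by
      rw [grid_scale, rnite_block a b _ hb]; push_cast; rfl)
  rw [h]
  have hs : ∑ a ∈ range (2 ^ 0), ∑ b ∈ range (2 ^ (j + 1)),
      (if 2 * b < 2 ^ (j + 1) then (0 : K) else if 2 ^ (j + 1) < 2 * b then 1
        else if Odd a then 1 else 0) = 2 ^ j - 1 := by
    rw [show (2 : ℕ) ^ (j + 1) = 2 * 2 ^ j by ring]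
    rw [sum_congr rfl (fun a _ => sum_ite_rnite_extra (2 ^ j) Nat.one_le_two_pow _)]
    simp
  rw [hs]; field_simp; ring

end Literature.ComputerArithmetic.FitzgibbonFelix2025.LimitedBits

end

/-! ## (3/3) `SRFewBitsDictionary.lean` -/

section

namespace Literature.ComputerArithmetic.FitzgibbonFelix2025.LimitedBits

open Literature.ComputerArithmetic.P3109
open Literature.ComputerArithmetic.FitzgibbonFelix2025
open Finset

variable {K : Type*} [Field K] [LinearOrder K] [IsStrictOrderedRing K] [FloorRing K]

/-! ### Dictionary with the P3109 stochastic modes -/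

/-- **SRFF = StochasticA**: `δ̃ + n 2^{-N} ≥ 1 ⟺ ⌊δ̃ 2^N⌋ + n ≥ 2^N`, for every `δ̃` and `n`.
[cite: FitzgibbonFelix2025, §II-B, §III-B–F, eq. (6)–(8), App. A-A–A-D] -/
theorem rsrff_iff_stochasticA (N n : ℕ) (δ : K) : RSRFF N δ n ↔ StochasticA N n δ := by
  unfold RSRFF StochasticA
  have h2 : (0 : K) < 2 ^ N := by positivity
  rw [show δ + (n : K) / 2 ^ N = (δ * 2 ^ N + n) / 2 ^ N by field_simp, le_div_iff₀ h2, one_mul,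
    show ((2 : ℤ) ^ N ≤ ⌊δ * 2 ^ N⌋ + n) ↔ ((2 : ℤ) ^ N - n ≤ ⌊δ * 2 ^ N⌋) from
      ⟨fun h => by linarith, fun h => by linarith⟩, Int.le_floor]
  push_cast
  constructor <;> intro h <;> linarith

/-- **SRF = StochasticB**: `δ̃ + (n + ½) 2^{-N} ≥ 1 ⟺ ⌊δ̃ 2^{N+1}⌋ + 2n + 1 ≥ 2^{N+1}`.
[cite: FitzgibbonFelix2025, §II-B, §III-B–F, eq. (6)–(8), App. A-A–A-D] -/
theorem rsrf_iff_stochasticB (N n : ℕ) (δ : K) : RSRF N δ n ↔ StochasticB N n δ := by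
  unfold RSRF StochasticB
  have h2 : (0 : K) < 2 ^ (N + 1) := by positivity
  rw [show δ + ((n : K) + 1 / 2) / 2 ^ N = (δ * 2 ^ (N + 1) + (2 * n + 1)) / 2 ^ (N + 1) by
      rw [pow_succ]; field_simp, le_div_iff₀ h2, one_mul,
    show ((2 : ℤ) ^ (N + 1) ≤ ⌊δ * 2 ^ (N + 1)⌋ + (2 * n + 1)) ↔
      ((2 : ℤ) ^ (N + 1) - (2 * n + 1) ≤ ⌊δ * 2 ^ (N + 1)⌋) from
      ⟨fun h => by linarith, fun h => by linarith⟩, Int.le_floor]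
  push_cast
  constructor <;> intro h <;> linarith

omit [FloorRing K] in
/-- SRFF applied to an `N`-bit integer count `r`: `r 2^{-N} + n 2^{-N} ≥ 1 ⟺ r + n ≥ 2^N`.
[cite: FitzgibbonFelix2025, §II-B, §III-B–F, eq. (6)–(8), App. A-A–A-D] -/
theorem rsrff_intCast_div_iff (N n : ℕ) (r : ℤ) :
    RSRFF N ((r : K) / 2 ^ N) n ↔ (2 : ℤ) ^ N ≤ r + n := by
  unfold RSRFF
  have h2 : (0 : K) < 2 ^ N := by positivity
  rw [show (r : K) / 2 ^ N + (n : K) / 2 ^ N = (r + n) / 2 ^ N by field_simp, le_div_iff₀ h2,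
    one_mul, ← Int.cast_le (R := K)]
  push_cast
  exact Iff.rfl

/-- **SRC with round-to-nearest-even = StochasticC**: `R_SRFF(RNE(δ̃ 2^N) 2^{-N}, n) ⟺
RNITE(δ̃ 2^N) + n ≥ 2^N`.
[cite: FitzgibbonFelix2025, §II-B, §III-B–F, eq. (6)–(8), App. A-A–A-D] -/
theorem rsrc_rnite_iff_stochasticC (N n : ℕ) (δ : K) :
    RSRC (fun y => rnite y) N δ n ↔ StochasticC N n δ := by
  unfold RSRC StochasticC
  exact rsrff_intCast_div_iff N n _

/-- **SRC with round-half-up (`round`, ties away on `[0, ∞)`) is literally SRF**: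
`⌊δ̃ 2^N + ½⌋ + n ≥ 2^N ⟺ δ̃ + (n + ½) 2^{-N} ≥ 1`, for every `δ̃` and `n`.
[cite: FitzgibbonFelix2025, §II-B, §III-B–F, eq. (6)–(8), App. A-A–A-D] -/
theorem rsrc_round_iff_rsrf (N n : ℕ) (δ : K) : RSRC round N δ n ↔ RSRF N δ n := by
  unfold RSRC
  rw [rsrff_intCast_div_iff, round_eq]
  unfold RSRF
  have h2 : (0 : K) < 2 ^ N := by positivity
  rw [show δ + ((n : K) + 1 / 2) / 2 ^ N = (δ * 2 ^ N + 1 / 2 + n) / 2 ^ N by field_simp; ring,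
    le_div_iff₀ h2, one_mul,
    show ((2 : ℤ) ^ N ≤ ⌊δ * 2 ^ N + 1 / 2⌋ + n) ↔ ((2 : ℤ) ^ N - n ≤ ⌊δ * 2 ^ N + 1 / 2⌋) from
      ⟨fun h => by linarith, fun h => by linarith⟩, Int.le_floor]
  push_cast
  constructor <;> intro h <;> linarith

/-! ### The paper's bias functionals are the away-probabilities minus the residual -/

omit [LinearOrder K] [IsStrictOrderedRing K] [FloorRing K] in
/-- A predicate agreeing with a P3109 mode has pointwise bias `awayCount/2^N − x`.
[cite: FitzgibbonFelix2025, §II-B, §III-B–F, eq. (6)–(8), App. A-A–A-D] -/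
theorem pointBias_eq_awayCount (mode : ℕ → ℕ → K → Prop) [∀ N R η, Decidable (mode N R η)]
    (R : K → ℕ → Prop) [∀ x n, Decidable (R x n)] {N : ℕ} (hR : ∀ x n, R x n ↔ mode N n x)
    (x : K) : pointBias R N x = (awayCount mode N x : K) / 2 ^ N - x := by
  unfold pointBias awayCount
  rw [natCast_card_filter]
  congr 1; congr 1
  exact sum_congr rfl (fun n _ => if_congr (hR x n) rfl rfl)

/-- `bias_SRFF(x) = P_A(x) − x` for `0 ≤ x < 1`.
[cite: FitzgibbonFelix2025, §II-B, §III-B–F, eq. (6)–(8), App. A-A–A-D] -/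
theorem pointBias_rsrff {N : ℕ} {x : K} (h0 : 0 ≤ x) (h1 : x < 1) :
    pointBias (RSRFF N) N x = probAwayA N x - x := by
  rw [pointBias_eq_awayCount StochasticA (RSRFF N) (fun x n => rsrff_iff_stochasticA N n x),
    awayCount_stochasticA_div h0 h1]

/-- `bias_SRF(x) = P_B(x) − x` for `0 ≤ x < 1`.
[cite: FitzgibbonFelix2025, §II-B, §III-B–F, eq. (6)–(8), App. A-A–A-D] -/
theorem pointBias_rsrf {N : ℕ} {x : K} (h0 : 0 ≤ x) (h1 : x < 1) :
    pointBias (RSRF N) N x = probAwayB N x - x := by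
  rw [pointBias_eq_awayCount StochasticB (RSRF N) (fun x n => rsrf_iff_stochasticB N n x),
    awayCount_stochasticB_div h0 h1]

/-- `bias_SRC(x) = P_C(x) − x` for `0 ≤ x < 1` (round-to-nearest-even pre-rounding).
[cite: FitzgibbonFelix2025, §II-B, §III-B–F, eq. (6)–(8), App. A-A–A-D] -/
theorem pointBias_rsrc {N : ℕ} {x : K} (h0 : 0 ≤ x) (h1 : x < 1) :
    pointBias (RSRC (fun y => rnite y) N) N x = probAwayC N x - x := by
  rw [pointBias_eq_awayCount StochasticC (RSRC (fun y => rnite y) N)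
    (fun x n => rsrc_rnite_iff_stochasticC N n x), awayCount_stochasticC_div h0 h1]

omit [FloorRing K] in
/-- Grid residuals lie in `[0, 1)`.
[cite: FitzgibbonFelix2025, §II-B, §III-B–F, eq. (6)–(8), App. A-A–A-D] -/
theorem grid_mem {D i : ℕ} (hi : i ∈ range (2 ^ D)) :
    0 ≤ (i : K) / 2 ^ D ∧ (i : K) / 2 ^ D < 1 := by
  have h2 : (0 : K) < 2 ^ D := by positivity
  refine ⟨by positivity, ?_⟩
  rw [div_lt_one h2]
  exact_mod_cast mem_range.1 hi

/-- `bias_{SRFF,D}` is the grid average of `P_A − x`.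
[cite: FitzgibbonFelix2025, §II-B, §III-B–F, eq. (6)–(8), App. A-A–A-D] -/
theorem gridBias_rsrff (N D : ℕ) : gridBias (RSRFF (K := K) N) N D
    = (∑ i ∈ range (2 ^ D), (probAwayA N ((i : K) / 2 ^ D) - (i : K) / 2 ^ D)) / 2 ^ D := by
  unfold gridBias
  rw [sum_congr rfl (fun i hi => pointBias_rsrff (grid_mem hi).1 (grid_mem hi).2)]

/-- `bias_{SRF,D}` is the grid average of `P_B − x`.
[cite: FitzgibbonFelix2025, §II-B, §III-B–F, eq. (6)–(8), App. A-A–A-D] -/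
theorem gridBias_rsrf (N D : ℕ) : gridBias (RSRF (K := K) N) N D
    = (∑ i ∈ range (2 ^ D), (probAwayB N ((i : K) / 2 ^ D) - (i : K) / 2 ^ D)) / 2 ^ D := by
  unfold gridBias
  rw [sum_congr rfl (fun i hi => pointBias_rsrf (grid_mem hi).1 (grid_mem hi).2)]

/-- `bias_{SRC,D}` (RNE pre-rounding) is the grid average of `P_C − x`.
[cite: FitzgibbonFelix2025, §II-B, §III-B–F, eq. (6)–(8), App. A-A–A-D] -/
theorem gridBias_rsrc (N D : ℕ) : gridBias (RSRC (K := K) (fun y => rnite y) N) N D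
    = (∑ i ∈ range (2 ^ D), (probAwayC N ((i : K) / 2 ^ D) - (i : K) / 2 ^ D)) / 2 ^ D := by
  unfold gridBias
  rw [sum_congr rfl (fun i hi => pointBias_rsrc (grid_mem hi).1 (grid_mem hi).2)]

/-- `bias_{SRC∘round,D} = bias_{SRF,D}`.
[cite: FitzgibbonFelix2025, §II-B, §III-B–F, eq. (6)–(8), App. A-A–A-D] -/
theorem gridBias_rsrc_round (N D : ℕ) :
    gridBias (RSRC (K := K) round N) N D = gridBias (RSRF (K := K) N) N D := by
  unfold gridBias pointBias
  simp_rw [rsrc_round_iff_rsrf]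

/-! ### The facts of [FitzgibbonFelix2025] §III-E/F and App. A-C/A-D, discharged -/

/-- **§III-F** over any field, and WITHOUT the paper's restriction `N ≤ D`: SRC with
round-to-nearest-even pre-rounding is unbiased on average over every input grid `2^{-D}ℤ ∩ [0,1)`,
for every `D`, as soon as `N ≥ 1` (for `D ≤ N` the pre-rounding is exact and SRC = SRFF).
[cite: FitzgibbonFelix2025, §II-B, §III-B–F, eq. (6)–(8), App. A-A–A-D] -/
theorem src_gridBias_eq_zero {N : ℕ} (D : ℕ) (h1 : 1 ≤ N) :
    gridBias (RSRC (K := K) (fun y => rnite y) N) N D = 0 := by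
  rw [gridBias_rsrc]
  rcases Nat.lt_or_ge N D with h | h
  · exact gridAvg_probAwayC h1 h
  · exact gridAvg_probAwayC_of_le h

/-! ### The infinite-precision facts of §III-C/D (App. A-A/A-B), discharged -/

open MeasureTheory in
/-- `∫₀¹ 1[x + c ≥ 1] dx = c` for `0 ≤ c < 1` (the measure of `[1 − c, 1]`).
[cite: FitzgibbonFelix2025, §II-B, §III-B–F, eq. (6)–(8), App. A-A–A-D] -/
theorem integral_ite_one_le_add (c : ℝ) (h0 : 0 ≤ c) (h1 : c < 1) :
    ∫ x in (0 : ℝ)..1, (if 1 ≤ x + c then (1 : ℝ) else 0) = c := by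
  have hind : (fun x : ℝ => if 1 ≤ x + c then (1 : ℝ) else 0)
      = Set.indicator (Set.Ici (1 - c)) (fun _ => (1 : ℝ)) := by
    funext x
    simp only [Set.indicator, Set.mem_Ici, sub_le_iff_le_add]
  rw [intervalIntegral.integral_of_le zero_le_one, hind,
    setIntegral_indicator measurableSet_Ici, setIntegral_const, smul_eq_mul, mul_one]
  have : Set.Ioc (0 : ℝ) 1 ∩ Set.Ici (1 - c) = Set.Icc (1 - c) 1 := by
    ext x; simp only [Set.mem_inter_iff, Set.mem_Ioc, Set.mem_Ici, Set.mem_Icc]; constructor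
    · rintro ⟨⟨-, hx1⟩, hx⟩; exact ⟨hx, hx1⟩
    · rintro ⟨hx, hx1⟩; exact ⟨⟨by linarith, hx1⟩, hx⟩
  rw [this, Measure.real, Real.volume_Icc, ENNReal.toReal_ofReal (by linarith)]
  ring

/-! ### Completions and caveats not in the paper -/

/-- For `D ≤ N` SRFF resolves every grid input: `bias_{SRFF,D} = 0`.
[cite: FitzgibbonFelix2025, §II-B, §III-B–F, eq. (6)–(8), App. A-A–A-D] -/
theorem srff_gridBias_of_le {N D : ℕ} (hDN : D ≤ N) : gridBias (RSRFF (K := K) N) N D = 0 := by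
  rw [gridBias_rsrff]; exact gridAvg_probAwayA_of_le hDN

/-- For `D ≤ N`: `bias_{SRF,D} = 0` (so App. A-D's value `2^{-(D+1)}` needs `N < D`, not `N ≤ D`).
[cite: FitzgibbonFelix2025, §II-B, §III-B–F, eq. (6)–(8), App. A-A–A-D] -/
theorem srf_gridBias_of_le {N D : ℕ} (hDN : D ≤ N) : gridBias (RSRF (K := K) N) N D = 0 := by
  rw [gridBias_rsrf]; exact gridAvg_probAwayB_of_le hDN

/-- For `D ≤ N`: `bias_{SRC,D} = 0`.
[cite: FitzgibbonFelix2025, §II-B, §III-B–F, eq. (6)–(8), App. A-A–A-D] -/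
theorem src_gridBias_of_le {N D : ℕ} (hDN : D ≤ N) :
    gridBias (RSRC (K := K) (fun y => rnite y) N) N D = 0 := by
  rw [gridBias_rsrc]; exact gridAvg_probAwayC_of_le hDN

/-- **`1 ≤ N` is necessary in §III-F**: with zero random bits SRC is deterministic
round-to-nearest-even, whose grid bias is `−2^{-(D+1)}` for every `D ≥ 1`.
[cite: FitzgibbonFelix2025, §II-B, §III-B–F, eq. (6)–(8), App. A-A–A-D] -/
theorem src_gridBias_zero_bits {D : ℕ} (hD : 1 ≤ D) :
    gridBias (RSRC (K := K) (fun y => rnite y) 0) 0 D = -(1 / 2 ^ (D + 1)) := by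
  rw [gridBias_rsrc]; exact gridAvg_probAwayC_zero_bits hD

/-- **Ties-away pre-rounding does not correct SRFF**: `bias_{SRC∘round,D} = 2^{-(D+1)}` for
`N < D` (it is SRF).
[cite: FitzgibbonFelix2025, §II-B, §III-B–F, eq. (6)–(8), App. A-A–A-D] -/
theorem srcRound_gridBias {N D : ℕ} (hND : N < D) :
    gridBias (RSRC (K := K) round N) N D = 1 / 2 ^ (D + 1) := by
  rw [gridBias_rsrc_round, gridBias_rsrf]; exact gridAvg_probAwayB hND

/-! ### Kernel spot-checks over `ℚ` (the definitions compute; independent of the proofs) -/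

/-- `D = 5`, `N = 3` (BFloat16 → a precision-3 format, the paper's Fig. 2 setting up to the
number of bits): `bias_{SRFF,5} = (2^{-5} − 2^{-3})/2 = −3/64 = −0.046875`,
`bias_{SRF,5} = 2^{-6} = 0.015625`, `bias_{SRC,5} = 0` — the three values printed in Fig. 2.
[cite: FitzgibbonFelix2025, §II-B, §III-B–F, eq. (6)–(8), App. A-A–A-D] -/
theorem fig2_values :
    gridBias (RSRFF (K := ℚ) 3) 3 5 = -3 / 64 ∧ gridBias (RSRF (K := ℚ) 3) 3 5 = 1 / 64 ∧
      gridBias (RSRC (K := ℚ) (fun y => rnite y) 3) 3 5 = 0 := by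
  refine ⟨?_, ?_, ?_⟩
  · rw [gridBias_rsrff, gridAvg_probAwayA (by norm_num)]; norm_num
  · rw [gridBias_rsrf, gridAvg_probAwayB (by norm_num)]; norm_num
  · exact src_gridBias_eq_zero 5 (by norm_num)

/-- Raw evaluation of the typed definitions on a small grid (`N = 2`, `D = 3`), independent of
the theorems above: `bias_{SRFF,3} = −2^{-4}`, `bias_{SRF,3} = 2^{-4}`, `bias_{SRC,3} = 0`.
[cite: FitzgibbonFelix2025, §II-B, §III-B–F, eq. (6)–(8), App. A-A–A-D] -/
theorem smallGrid_eval :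
    gridBias (RSRFF (K := ℚ) 2) 2 3 = -1 / 16 ∧ gridBias (RSRF (K := ℚ) 2) 2 3 = 1 / 16 ∧
      gridBias (RSRC (K := ℚ) (fun y => rnite y) 2) 2 3 = 0 := by
  refine ⟨?_, ?_, ?_⟩ <;>
  · simp only [gridBias, pointBias]
    norm_num [RSRFF, RSRF, RSRC, rnite, Int.odd_iff, Finset.sum_range_succ, -Finset.sum_boole]

end Literature.ComputerArithmetic.FitzgibbonFelix2025.LimitedBits

end

/-! ## (closing) The seven named facts of `FewBitSR.lean`, discharged in their own namespace -/

section

namespace Literature.ComputerArithmetic.FitzgibbonFelix2025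

open Literature.ComputerArithmetic.P3109
open Finset
open LimitedBits

/-- **App. A-C (exact form)** (DISCHARGED): `bias_{SRFF,D} = (2^{-D} − 2^{-N})/2` for `N ≤ D`.
[cite: FitzgibbonFelix2025, §III-E, App. A-C] -/
theorem SRFFGridBias_holds : SRFFGridBias := fun N D h => by
  rw [gridBias_rsrff]; exact gridAvg_probAwayA h

/-- **App. A-C (one-sided form)** (DISCHARGED): `bias_{SRFF,D} ≤ (2^{-D} − 2^{-N})/2`, all `N, D`.
[cite: FitzgibbonFelix2025, §III-E, App. A-C] -/
theorem SRFFGridBiasLe_holds : SRFFGridBiasLe := fun N D => by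
  rw [gridBias_rsrff]; exact gridAvg_probAwayA_le N D

/-- **App. A-D (exact form)** (DISCHARGED): `bias_{SRF,D} = 2^{-(D+1)}` for `N < D`.
[cite: FitzgibbonFelix2025, App. A-D] -/
theorem SRFGridBias_holds : SRFGridBias := fun N D h => by
  rw [gridBias_rsrf]; exact gridAvg_probAwayB h

/-- **App. A-D (one-sided form)** (DISCHARGED): `bias_{SRF,D} ≤ 2^{-(D+1)}`, all `N, D`.
[cite: FitzgibbonFelix2025, §III-E, App. A-D] -/
theorem SRFGridBiasLe_holds : SRFGridBiasLe := fun N D => by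
  rw [gridBias_rsrf]; exact gridAvg_probAwayB_le N D

/-- **§III-F** (DISCHARGED): the paper's SRC claim, with RNE pre-rounding and `1 ≤ N ≤ D`.
[cite: FitzgibbonFelix2025, §III-F, eq. (8)] -/
theorem SRCGridBias_holds : SRCGridBias := fun _ D h1 _ => src_gridBias_eq_zero D h1

/-- **§III-C / App. A-A** (DISCHARGED): over residuals uniform on `[0,1)`, `bias_SRFF = −2^{-(N+1)}`:
each random word `n` rounds away on `[1 − n2^{-N}, 1]`, of length `n 2^{-N}`.
[cite: FitzgibbonFelix2025, §III-C, App. A-A] -/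
theorem SRFFContBias_holds : SRFFContBias := by
  intro N
  unfold contBias
  have h2 : (0 : ℝ) < 2 ^ N := by positivity
  have hI : ∀ n ∈ range (2 ^ N),
      ∫ x in (0 : ℝ)..1, (if RSRFF N x n then (1 : ℝ) else 0) = (n : ℝ) / 2 ^ N := by
    intro n hn
    have hn' : (n : ℝ) < 2 ^ N := by exact_mod_cast mem_range.1 hn
    have e : (fun x : ℝ => if RSRFF N x n then (1 : ℝ) else 0)
        = fun x => if 1 ≤ x + (n : ℝ) / 2 ^ N then (1 : ℝ) else 0 := by
      funext x; exact if_congr Iff.rfl rfl rfl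
    rw [e]
    exact integral_ite_one_le_add _ (by positivity) (by rw [div_lt_one h2]; exact hn')
  rw [sum_congr rfl hI, ← sum_div, sum_range_natCast]
  push_cast
  field_simp
  ring

/-- **§III-D / App. A-B** (DISCHARGED): `bias_SRF = 0` over residuals uniform on `[0,1)`: word `n`
rounds away on `[1 − (n+½)2^{-N}, 1]`.
[cite: FitzgibbonFelix2025, §III-D, App. A-B] -/
theorem SRFContBias_holds : SRFContBias := by
  intro N
  unfold contBias
  have h2 : (0 : ℝ) < 2 ^ N := by positivity
  have hI : ∀ n ∈ range (2 ^ N),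
      ∫ x in (0 : ℝ)..1, (if RSRF N x n then (1 : ℝ) else 0) = ((n : ℝ) + 1 / 2) / 2 ^ N := by
    intro n hn
    have hn' : (n : ℝ) + 1 ≤ 2 ^ N := by exact_mod_cast mem_range.1 hn
    have e : (fun x : ℝ => if RSRF N x n then (1 : ℝ) else 0)
        = fun x => if 1 ≤ x + ((n : ℝ) + 1 / 2) / 2 ^ N then (1 : ℝ) else 0 := by
      funext x; exact if_congr Iff.rfl rfl rfl
    rw [e]
    exact integral_ite_one_le_add _ (by positivity) (by rw [div_lt_one h2]; linarith)
  rw [sum_congr rfl hI, ← sum_div, sum_add_distrib, sum_range_natCast, sum_const, card_range,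
    nsmul_eq_mul]
  push_cast
  field_simp
  ring

end Literature.ComputerArithmetic.FitzgibbonFelix2025

end

end
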